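import Mathlib
import HarnessLib
import Summits.HubbardSuperconductivity.HubbardSuperconductivity.Theorems.KLProgrammeKLRegimeEngineTowerLevReadoutFitFBorn

/-!
# Route `KLProgramme` — crux K3 ENGINE (stmt-HubbardSuperconductivity-20437 `KLRegimeEngineV17F2`), stub (b) v2, THE LEVELS PACKAGE (ℓ), located item
# «(ℓ)-READOUT-CE-DIM» (p4 g21, STATUS l.10546): RO-4‴ WITH THE SHARP ENVELOPE — the increment's V-term keeps its `(2τψQ′)^p` and loses `ψ`, so that the
# read-out constant `A_tot` scales like `ε_x = β/(2M)` (as `A_ro` does) and the `CE` threshold `Q_tot·ε_x²·B·max 1 (A_tot/ε_x) ≤ CE` is uniform in `M`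
# (cell gate-hubbard-kl, seat hubbard-kl-k3c3-p2 g16; twin of …TowerLevReadoutFitFBorn)

WHY.  `readoutBracket_le_law_mul` (…ReadoutIncrJump §3) majorises the increment's V-term `e·ψ·(2τψQ″)^{p−1}·TY·Yy` by `e·ψ·TY·Yy·(D_inc·M_q)^p` using
`M_q^{p−1} ≤ M_q^p` — valid, but it spends one factor `M_q ≥ 2τψQ″`, which in the model's currency grows like `(2M/β)²`; the resulting `A_tot` is then two
powers of `2M/β` too large for a fixed public constant.  The identity `ψ·(2τψQ″)^{p−1} = (2τψQ″)^p/(2τQ″)` (`p ≥ 1`, `τ, Q″ > 0`) avoids the loss: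

* `readoutBracket_le_law_mul_sharp` — `A_ro·Q_ro^p + C_inc·D_inc^p·(A″(4Q″)^p·X₁ + e·ψ·(2τψQ″)^{p−1}·TY·Yy) ≤ (A_ro + C_inc·(A″X₁ + e·TY·Yy/(2τQ″)))·(D_inc·M_q)^p`;
* **`readoutLevF_le_levelsRHS_of_bornRows_sharp`** — `readoutLevF_le_levelsRHS_of_bornRows` (p689258) with the single binder change
  `A_tot = A_ro + C_inc·(A′·x₁/(1−x₁) + e·(τY)·(Φ(τY)/(1−Φ(τY)))/(2τQ′))`; proof identical but for the bracket.
Compositions of landed theorems and real algebra; nothing about the model is asserted beyond them; nothing asserts (ℓ), any stub, K3 or superconductivity.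
References: BGM 2006 §2.8 (2.82)–(2.84), (2.93)–(2.98), Lemma 2.5 (2.98) [cite: BenfattoGiulianiMastropietro2006].
-/

noncomputable section

namespace Summit.HubbardSuperconductivity.HubbardSuperconductivity.Theorems.EngineV8

set_option linter.dupNamespace false -- summit = problem name (single-conjunct summit), D-0017

open Classical
open Real Finset Literature.MathematicalPhysics.QuantumLattice Literature.Probability.LatticeModels GrassmannAlgebra
open Literature.MathematicalPhysics.QuantumLattice.FermiRG
open Summit.HubbardSuperconductivity.HubbardSuperconductivity.Theorems.KLProgrammeLegKernels
open Summit.HubbardSuperconductivity.HubbardSuperconductivity.Theorems.KLRegimeSplit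
open Summit.HubbardSuperconductivity.HubbardSuperconductivity.Theorems.KLRegimeWick
open Summit.HubbardSuperconductivity.HubbardSuperconductivity.Theorems.TorusFourierL2
open Summit.HubbardSuperconductivity.HubbardSuperconductivity.Theorems.DispersionFlow
open Summit.HubbardSuperconductivity.HubbardSuperconductivity.Theorems.PerturbedFermiCurve

variable {L M : ℕ} [NeZero L] [NeZero M]

/-! ## §1 The sharp bracket -/

/-- **The bracket with the increment constant under one law, SHARP in the V-term**: `Q_tot = D_inc·max 1 (max Q_ro (max (4Q″) (2τψQ″)))` as in
`readoutBracket_le_law_mul`, but `A_tot♯ = A_ro + C_inc·(A″X₁ + e·TY·Yy/(2τQ″))` — by `ψ·(2τψQ″)^{p−1} = (2τψQ″)^p/(2τQ″)` (`1 ≤ p`, `0 < τ`, `0 < Q″`).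
[folklore] -/
theorem readoutBracket_le_law_mul_sharp {Aro Qro A'' Q'' ψ τ X₁ TY Yy Cinc Dinc : ℝ} (hAro : 0 ≤ Aro) (hQro : 0 ≤ Qro) (hA'' : 0 ≤ A'')
    (hQ'' : 0 < Q'') (hψ : 0 ≤ ψ) (hτ : 0 < τ) (hX₁ : 0 ≤ X₁) (hTY : 0 ≤ TY) (hYy : 0 ≤ Yy) (hCinc : 0 ≤ Cinc) (hDinc : 1 ≤ Dinc) {p : ℕ} (hp : 1 ≤ p) :
    Aro * Qro ^ p + Cinc * Dinc ^ p * (A'' * (4 * Q'') ^ p * X₁ + exp 1 * ψ * (2 * τ * ψ * Q'') ^ (p - 1) * TY * Yy) ≤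
      (Aro + Cinc * (A'' * X₁ + exp 1 * TY * Yy / (2 * τ * Q''))) * (Dinc * max 1 (max Qro (max (4 * Q'') (2 * τ * ψ * Q'')))) ^ p := by
  have hD0 : 0 ≤ Dinc := zero_le_one.trans hDinc
  set Mq : ℝ := max 1 (max Qro (max (4 * Q'') (2 * τ * ψ * Q''))) with hMq
  have hM1 : 1 ≤ Mq := le_max_left _ _
  have hM0 : 0 ≤ Mq := zero_le_one.trans hM1
  have h1 : Qro ≤ Mq := (le_max_left _ _).trans (le_max_right _ _)
  have h2 : 4 * Q'' ≤ Mq := ((le_max_left _ _).trans (le_max_right _ _)).trans (le_max_right _ _)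
  have h3 : 2 * τ * ψ * Q'' ≤ Mq := ((le_max_right _ _).trans (le_max_right _ _)).trans (le_max_right _ _)
  have hDp : 1 ≤ Dinc ^ p := one_le_pow₀ hDinc
  have hp1 : Qro ^ p ≤ (Dinc * Mq) ^ p := by
    rw [mul_pow Dinc Mq p]
    exact (pow_le_pow_left₀ hQro h1 p).trans (le_mul_of_one_le_left (pow_nonneg hM0 _) hDp)
  have hp2 : Dinc ^ p * (4 * Q'') ^ p ≤ (Dinc * Mq) ^ p := by
    rw [mul_pow Dinc Mq p]; exact mul_le_mul_of_nonneg_left (pow_le_pow_left₀ (by positivity) h2 p) (by positivity)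
  have hp3 : Dinc ^ p * (2 * τ * ψ * Q'') ^ p ≤ (Dinc * Mq) ^ p := by
    rw [mul_pow Dinc Mq p]; exact mul_le_mul_of_nonneg_left (pow_le_pow_left₀ (by positivity) h3 p) (by positivity)
  -- the identity that keeps `ψ` inside the `p`-th power
  have hid : exp 1 * ψ * (2 * τ * ψ * Q'') ^ (p - 1) * TY * Yy = exp 1 * TY * Yy / (2 * τ * Q'') * (2 * τ * ψ * Q'') ^ p := by
    obtain ⟨q, rfl⟩ : ∃ q, p = q + 1 := ⟨p - 1, by omega⟩
    rw [Nat.add_sub_cancel, pow_succ]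
    field_simp
  have he : 0 ≤ exp 1 * TY * Yy / (2 * τ * Q'') := by positivity
  calc Aro * Qro ^ p + Cinc * Dinc ^ p * (A'' * (4 * Q'') ^ p * X₁ + exp 1 * ψ * (2 * τ * ψ * Q'') ^ (p - 1) * TY * Yy)
      = Aro * Qro ^ p + Cinc * (A'' * (Dinc ^ p * (4 * Q'') ^ p) * X₁ + exp 1 * TY * Yy / (2 * τ * Q'') * (Dinc ^ p * (2 * τ * ψ * Q'') ^ p)) := by
        rw [hid]; ring
    _ ≤ Aro * (Dinc * Mq) ^ p + Cinc * (A'' * (Dinc * Mq) ^ p * X₁ + exp 1 * TY * Yy / (2 * τ * Q'') * (Dinc * Mq) ^ p) := by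
        refine add_le_add (mul_le_mul_of_nonneg_left hp1 hAro) (mul_le_mul_of_nonneg_left (add_le_add ?_ ?_) hCinc)
        · exact mul_le_mul_of_nonneg_right (mul_le_mul_of_nonneg_left hp2 hA'') hX₁
        · exact mul_le_mul_of_nonneg_left hp3 he
    _ = (Aro + Cinc * (A'' * X₁ + exp 1 * TY * Yy / (2 * τ * Q''))) * (Dinc * Mq) ^ p := by ring

/-! ## §2 RO-4‴ with the sharp envelope -/

omit [NeZero L] [NeZero M] in
/-- **THE READ-OUT AT ANY LEVEL `dk ≤ j` IS BELOW `KernelNormsLevels`' RIGHT-HAND SIDE, FROM NAMED INPUTS WITH THE PARTIAL STEP BORN AT `F_{dk}` — SHARP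
ENVELOPE** («(ℓ)-READOUT-CE-DIM»): `readoutLevF_le_levelsRHS_of_bornRows` verbatim except the equational binder
`A_tot = A_ro + C_inc·(A′·x₁/(1−x₁) + e·(τY)·(y/(1−y))/(2τQ′))` (the increment's V-term without the spent `ψ·max`; `A_tot/ε_x` is then M-homogeneous of degree 0
when the inputs are). See the module docstring.
[cite: BenfattoGiulianiMastropietro2006, §2.8 (2.82)-(2.84), (2.93)-(2.98), Lemma 2.5 (2.98)] -/
theorem readoutLevF_le_levelsRHS_of_bornRows_sharp :
    ∃ C₁ C₂ Cinc Dinc : ℝ, 0 < C₁ ∧ 0 < C₂ ∧ 0 < Cinc ∧ 1 ≤ Dinc ∧ ∀ R : RenConsts, R.WF2 → ∃ c₃' : ℝ, 0 < c₃' ∧ ∃ U₀' : ℝ, 0 < U₀' ∧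
      ∀ (P : SplitConsts) (c : ℝ), P.WF → 0 < c → c ≤ klEngC₃6 P R → c ≤ c₃' →
      ∀ μ ∈ klWindowC, ∀ U : ℝ, 0 < U → U ≤ klEngU₀9 P R c → U ≤ U₀' → ∀ β : ℝ, klBetaMin ≤ β → β ≤ Real.exp (c / U ^ 2) →
      ∀ K : TrigPolyC4v, FrameOK R U (nScales β) μ K → ∀ (L M : ℕ) [NeZero L] [NeZero M],
      klEngL₃ β U ≤ L → klEngM₃ β U L ≤ M → ∀ d k j D : ℕ, 2 ≤ d → 1 ≤ k → d * k ≤ j → j ≤ nScales β + 1 → 3 ≤ D →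
      ∀ (A B Q Ab Qb : ℝ), 0 ≤ A → 1 ≤ B → 0 ≤ Q → 0 ≤ Ab → 0 ≤ Qb →
      -- the base datum at `F_{d−1}` and its unit law, at `λ = B·ε_j`
      ∀ Nb : Fin 5 → ℕ → ℝ, (∀ t p, 0 ≤ Nb t p) →
        (∀ (t : Fin 5) (p : ℕ) (Ωe' : Fin (2 * p) → Option (SectorLeg (sectorCount (d - 1)))), levelCount Ωe' = (t : ℕ) + 1 →
          klLevNormOf L M β μ K (d - 1) (2 * p) (klTowerInput L M β U μ K d 1) Ωe' ≤ Nb t p) →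
        (∀ (t : Fin 5) (p : ℕ), 3 ≤ p → Nb t p / klLevUnitF β M t p (d - 1) ≤ Ab * (B * epsCoupling P U j) ^ (p - 1) * Qb ^ p) →
      -- the law on the blocks `2 ≤ k′ ≤ k`
      (∀ k' : ℕ, 2 ≤ k' → k' ≤ k → ∀ (t : Fin 5) (p : ℕ), 3 ≤ p → p ≤ D →
        klTowerBLevF L M β U μ K d t k' p ≤ A * (B * epsCoupling P U j) ^ (p - 1) * Q ^ p) →
      ∀ (W Z σ Φ ψ τ A' Q' ι₁ ι₂ ι₃ : ℝ), 0 < W → 0 < Z → 0 ≤ σ → 0 ≤ Φ → 0 ≤ ψ → 0 < τ → 0 ≤ A' → 0 < Q' →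
      -- the Chernoff data of block `k` (exported by the law) and the imports at block `k`
      (∀ m, 4 ≤ m → m ≤ D → W * Z ^ m * klTowerMuLevF L M β U μ K d k m ≤ A' * (B * epsCoupling P U j) ^ (m - 1) * Q' ^ m) →
      W * Z ^ 3 * klTowerMuLevF L M β U μ K d k 3 ≤ ι₃ * (B * epsCoupling P U j) ^ 2 →
      W * Z ^ 1 * klTowerMuLevF L M β U μ K d k 1 ≤ ι₁ * (B * epsCoupling P U j) →
      W * Z ^ 2 * klTowerMuLevF L M β U μ K d k 2 ≤ ι₂ * (B * epsCoupling P U j) →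
      -- the five smallness rows at `(A′, Q′, λ)` (exported by the law)
      4 * σ * (B * epsCoupling P U j) * Q' < 1 → 2 * (B * epsCoupling P U j) * τ * Q' ≤ 1 → exp 1 * τ * (B * epsCoupling P U j) * Q' < 1 →
      Φ * (τ * (ι₁ * (B * epsCoupling P U j) + ι₂ / (2 * Q') + ι₃ / (4 * Q' ^ 2) + A' * Q' / 4)) < 1 →
      Φ * (exp 1 * τ * (ι₁ * (B * epsCoupling P U j)) + (exp 1 * τ) ^ 2 * (ι₂ * (B * epsCoupling P U j)) +
          (exp 1 * τ) ^ 3 * (ι₃ * (B * epsCoupling P U j) ^ 2) +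
        A' * (exp 1 * τ * Q') * ((exp 1 * τ * (B * epsCoupling P U j) * Q') ^ 3 / (1 - exp 1 * τ * (B * epsCoupling P U j) * Q'))) < 1 →
      -- the partial-block step at `(k, j)` BORN AT `F_{dk}` (the tail of k3c2-p3's `partialIncrLevF_le_kitStep_klEng`, verbatim shape)
      (∀ N : ℕ, 1 ≤ N → Φ * towerV D τ (fun m => W * Z ^ m * klTowerMuLevF L M β U μ K d k m) < 1 →
        ∀ (t : Fin 5) (q : ℕ) (Ωe : Fin (2 * q + 1 + 1) → Option (SectorLeg (sectorCount (d * k)))), levelCount Ωe = (t : ℕ) + 1 →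
        klLevNormOf L M β μ K (d * k) (2 * q + 1 + 1) (klEffectiveAction L M β U μ K klE0 j - klTowerInput L M β U μ K d k) Ωe /
            klLevUnitF β M t (q + 1) (d * k) ≤
          towerFO D σ (fun m => W * Z ^ m * klTowerMuLevF L M β U μ K d k m) (q + 1) +
            ∑ n' ∈ Icc 2 N, exp 1 * Φ ^ (n' - 1) * ψ ^ (q + 1) * towerS D τ (fun m => W * Z ^ m * klTowerMuLevF L M β U μ K d k m) n' (q + 1) +
            ψ ^ (q + 1) * exp 1 * towerV D τ (fun m => W * Z ^ m * klTowerMuLevF L M β U μ K d k m) *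
              (Φ * towerV D τ (fun m => W * Z ^ m * klTowerMuLevF L M β U μ K d k m)) ^ N /
              (1 - Φ * towerV D τ (fun m => W * Z ^ m * klTowerMuLevF L M β U μ K d k m))) →
      -- the read-out constants (equational binders) and the threshold
      ∀ (Aro Qro Qtot Atot : ℝ), Aro = (27 : ℝ) ^ 5 * (C₁ / C₂) * (Ab + (8 : ℝ) ^ (d - 1) * (A / (1 - ((2 : ℝ) ^ d)⁻¹))) →
        Qro = C₂ ^ 2 * max Qb (((2 : ℝ) ^ (d - 1))⁻¹ * max Q Qb) → Qtot = Dinc * max 1 (max Qro (max (4 * Q') (2 * τ * ψ * Q'))) →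
        Atot = Aro + Cinc * (A' * (4 * σ * (B * epsCoupling P U j) * Q' / (1 - 4 * σ * (B * epsCoupling P U j) * Q')) +
          exp 1 * (τ * (ι₁ * (B * epsCoupling P U j) + ι₂ / (2 * Q') + ι₃ / (4 * Q' ^ 2) + A' * Q' / 4)) *
            (Φ * (τ * (ι₁ * (B * epsCoupling P U j) + ι₂ / (2 * Q') + ι₃ / (4 * Q' ^ 2) + A' * Q' / 4)) /
              (1 - Φ * (τ * (ι₁ * (B * epsCoupling P U j) + ι₂ / (2 * Q') + ι₃ / (4 * Q' ^ 2) + A' * Q' / 4)))) / (2 * τ * Q')) →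
      ∀ CE : ℝ, Qtot * imagTimeWeight β M ^ 2 * B * max 1 (Atot / imagTimeWeight β M) ≤ CE →
      ∀ (t : Fin 5) (p : ℕ), 3 ≤ p → p ≤ D → 7 ≤ 2 * p + (t : ℕ) →
      ∀ Ωe : Fin (2 * p) → Option (SectorLeg (sectorCount j)), levelCount Ωe = (t : ℕ) + 1 →
        klLevNormOf L M β μ K j (2 * p) (klEffectiveAction L M β U μ K klE0 j) Ωe ≤
          CE ^ p * epsCoupling P U j ^ (p - 1) * (2 : ℝ) ^ ((3 * (p : ℤ) - 5) * j) * (((2 : ℝ) ^ j)⁻¹) ^ levelGainExp ((t : ℕ) + 1) := by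
  obtain ⟨C₁, C₂, hC₁, hC₂, h⟩ := readoutLevF_le_profileR_anyJump
  obtain ⟨C₁', C₂', hC₁', hC₂', hJ⟩ := floorJump_readout_le
  refine ⟨C₁, C₂, (27 : ℝ) ^ 5 * (C₁' / C₂'), max 1 (C₂' ^ 2), hC₁, hC₂, by positivity, le_max_left _ _, fun R hR2 => ?_⟩
  obtain ⟨c₃, hc₃, U₀, hU₀, h'⟩ := h R hR2
  obtain ⟨c₃'', hc₃'', U₀'', hU₀'', hJ'⟩ := hJ R hR2
  refine ⟨min c₃ c₃'', lt_min hc₃ hc₃'', min U₀ U₀'', lt_min hU₀ hU₀'', ?_⟩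
  intro P c hP hc hc6 hc₃' μ hμ U hU hU9 hU₀' β hβmin hβc K hK L M _ _ hL3 hM3 d k j D hd hk1 hkj hjN hD A B Q Ab Qb hA hB hQ hAb hQb Nb hNb0 hcar
    hlawb hIH W Z σ Φ ψ τ A' Q' ι₁ ι₂ ι₃ hW hZ hσ hΦ hψ hτ hA'0 hQ'0 hprof hprof3 himp₁ himp₂ hx₁ hx₂ hx₃ hy hθ hborn Aro Qro Qtot Atot hAro hQro hQtot
    hAtot CE hCE t p hp hpD hpt Ωe hlev
  have hcA : c ≤ c₃ := hc₃'.trans (min_le_left _ _)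
  have hcB : c ≤ c₃'' := hc₃'.trans (min_le_right _ _)
  have hUA : U ≤ U₀ := hU₀'.trans (min_le_left _ _)
  have hUB : U ≤ U₀'' := hU₀'.trans (min_le_right _ _)
  have hβ : 0 < β := KLRegimeSplit.pos_of_klBetaMin_le hβmin
  have hK1 : 1 ≤ P.Klam := hP.1
  have hKl : 0 ≤ P.Klam := le_trans zero_le_one hK1
  have hε : 0 < epsCoupling P U j := by
    unfold epsCoupling
    have : 0 < |U| + U ^ 2 * (j : ℝ) := by positivity
    positivity
  have hB0 : 0 < B := lt_of_lt_of_le one_pos hB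
  set lam : ℝ := B * epsCoupling P U j with hlamdef
  have hlam : 0 < lam := mul_pos hB0 hε
  have hu : 0 < klLevUnitF β M t p j := klLevUnitF_pos hβ t p j
  set μk : ℕ → ℝ := fun m => W * Z ^ m * klTowerMuLevF L M β U μ K d k m with hμk
  have hμ0 : ∀ m, 0 ≤ μk m := fun m =>
    mul_nonneg (by positivity) (klTowerMuLevF_nonneg (L := L) (M := M) hβ U μ K d k m)
  have hCinc0 : 0 < (27 : ℝ) ^ 5 * (C₁' / C₂') := by positivity
  have hDinc1 : (1 : ℝ) ≤ max 1 (C₂' ^ 2) := le_max_left _ _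
  have hDinc0 : (0 : ℝ) < max 1 (C₂' ^ 2) := lt_of_lt_of_le one_pos hDinc1
  -- the nonnegativity of the imports from the rows
  have hι₁0 : 0 ≤ ι₁ := by
    have h1 : 0 ≤ ι₁ * lam := (hμ0 1).trans himp₁
    rw [mul_comm] at h1
    exact nonneg_of_mul_nonneg_right h1 hlam
  have hι₂0 : 0 ≤ ι₂ := by
    have h1 : 0 ≤ ι₂ * lam := (hμ0 2).trans himp₂
    rw [mul_comm] at h1
    exact nonneg_of_mul_nonneg_right h1 hlam
  have hι₃0 : 0 ≤ ι₃ := by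
    have h1 : 0 ≤ ι₃ * lam ^ 2 := (hμ0 3).trans hprof3
    rw [mul_comm] at h1
    exact nonneg_of_mul_nonneg_right h1 (by positivity)
  -- (1) the re-measured part (RO-1, any jump), with the weight `27^{t+1} ≥ 1` dropped
  have hX₀0 : 0 ≤ klLevNormOf L M β μ K j (2 * p) (klTowerInput L M β U μ K d k) Ωe := klLevNormOf_nonneg hβ.le μ K j (2 * p) _ Ωe
  have hro27 := h' P c hP hc hc6 hcA μ hμ U hU hU9 hUA β hβmin hβc K hK L M hL3 hM3 d k j hd hk1 hkj hjN D A lam Q Ab Qb hA hlam.le hQ hAb hQb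
    Nb hNb0 hcar hlawb hIH t p hp hpD hpt Ωe hlev
  have hAro0 : 0 ≤ Aro := by
    have hρ1 : ((2 : ℝ) ^ d)⁻¹ < 1 := inv_lt_one_of_one_lt₀ (one_lt_pow₀ (by norm_num) (by omega))
    have : 0 ≤ A / (1 - ((2 : ℝ) ^ d)⁻¹) := div_nonneg hA (sub_nonneg.2 hρ1.le)
    rw [hAro]; positivity
  have hQro0 : 0 ≤ Qro := by
    have : 0 ≤ max Qb (((2 : ℝ) ^ (d - 1))⁻¹ * max Q Qb) := le_max_of_le_left hQb
    rw [hQro]; positivity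
  have hro : klLevNormOf L M β μ K j (2 * p) (klTowerInput L M β U μ K d k) Ωe / klLevUnitF β M t p j ≤ Aro * lam ^ (p - 1) * Qro ^ p := by
    have h27 : (1 : ℝ) ≤ (27 : ℝ) ^ ((t : ℕ) + 1) := one_le_pow₀ (by norm_num)
    have hq0 : 0 ≤ klLevNormOf L M β μ K j (2 * p) (klTowerInput L M β U μ K d k) Ωe / klLevUnitF β M t p j := div_nonneg hX₀0 hu.le
    calc klLevNormOf L M β μ K j (2 * p) (klTowerInput L M β U μ K d k) Ωe / klLevUnitF β M t p j
        ≤ (27 : ℝ) ^ ((t : ℕ) + 1) * klLevNormOf L M β μ K j (2 * p) (klTowerInput L M β U μ K d k) Ωe / klLevUnitF β M t p j := by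
          rw [mul_div_assoc]; exact le_mul_of_one_le_left hq0 h27
      _ ≤ _ := by rw [hAro, hQro]; exact hro27
  -- (2) `𝒱_j = 𝒱_{dk} + (𝒱_j − 𝒱_{dk})`: the public size is at most `ro + inc`
  have hpub : klLevNormOf L M β μ K j (2 * p) (klEffectiveAction L M β U μ K klE0 j) Ωe / klLevUnitF β M t p j ≤
      klLevNormOf L M β μ K j (2 * p) (klTowerInput L M β U μ K d k) Ωe / klLevUnitF β M t p j +
        klLevNormOf L M β μ K j (2 * p) (klEffectiveAction L M β U μ K klE0 j - klTowerInput L M β U μ K d k) Ωe / klLevUnitF β M t p j := by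
    rw [← add_div]
    refine div_le_div_of_nonneg_right ?_ hu.le
    have h := klLevNormOf_add_le hβ.le μ K j (2 * p) (klTowerInput L M β U μ K d k)
      (klEffectiveAction L M β U μ K klE0 j - klTowerInput L M β U μ K d k) Ωe
    rwa [add_sub_cancel] at h
  -- (3) the increment at `F_j` from the BORN step: zero at `j = dk`, the floor jump for `dk + 1 ≤ j`
  have hV0 : 0 ≤ towerV D τ μk := towerV_nonneg hτ.le hμ0
  have hkit0 : ∀ (N q : ℕ), Φ * towerV D τ μk < 1 →
      0 ≤ towerFO D σ μk q + ∑ n' ∈ Icc 2 N, exp 1 * Φ ^ (n' - 1) * ψ ^ q * towerS D τ μk n' q +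
        ψ ^ q * exp 1 * towerV D τ μk * (Φ * towerV D τ μk) ^ N / (1 - Φ * towerV D τ μk) := by
    intro N q hg
    have h1 : 0 ≤ towerFO D σ μk q := towerFO_nonneg hσ hμ0 q
    have h2 : 0 ≤ ∑ n' ∈ Icc 2 N, exp 1 * Φ ^ (n' - 1) * ψ ^ q * towerS D τ μk n' q :=
      sum_nonneg fun n' _ => by have := towerS_nonneg (D := D) hτ.le hμ0 n' q; positivity
    have h3 : 0 ≤ ψ ^ q * exp 1 * towerV D τ μk * (Φ * towerV D τ μk) ^ N / (1 - Φ * towerV D τ μk) :=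
      div_nonneg (by positivity) (sub_nonneg.2 hg.le)
    linarith
  have hincj : ∀ N : ℕ, 2 ≤ N → Φ * towerV D τ μk < 1 →
      klLevNormOf L M β μ K j (2 * p) (klEffectiveAction L M β U μ K klE0 j - klTowerInput L M β U μ K d k) Ωe / klLevUnitF β M t p j ≤
        (27 : ℝ) ^ 5 * (C₁' / C₂') * (max 1 (C₂' ^ 2)) ^ p * (towerFO D σ μk p + ∑ n' ∈ Icc 2 N, exp 1 * Φ ^ (n' - 1) * ψ ^ p * towerS D τ μk n' p +
          ψ ^ p * exp 1 * towerV D τ μk * (Φ * towerV D τ μk) ^ N / (1 - Φ * towerV D τ μk)) := by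
    intro N hN hg
    have hk0 := hkit0 N p hg
    by_cases hjk : d * k + 1 ≤ j
    · -- the born bound at `F_{dk}`, weighted, then jumped to `F_j`
      obtain ⟨q, rfl⟩ : ∃ q, p = q + 1 := ⟨p - 1, by omega⟩
      have ht := t.isLt
      have hbornW : ∀ Ωe' : Fin (2 * (q + 1)) → Option (SectorLeg (sectorCount (d * k))), levelCount Ωe' = (t : ℕ) + 1 →
          (27 : ℝ) ^ ((t : ℕ) + 1) * klLevNormOf L M β μ K (d * k) (2 * (q + 1))
              (klEffectiveAction L M β U μ K klE0 j - klTowerInput L M β U μ K d k) Ωe' / klLevUnitF β M t (q + 1) (d * k) ≤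
            (27 : ℝ) ^ ((t : ℕ) + 1) * (towerFO D σ μk (q + 1) + ∑ n' ∈ Icc 2 N, exp 1 * Φ ^ (n' - 1) * ψ ^ (q + 1) * towerS D τ μk n' (q + 1) +
              ψ ^ (q + 1) * exp 1 * towerV D τ μk * (Φ * towerV D τ μk) ^ N / (1 - Φ * towerV D τ μk)) := by
        intro Ωe' hlev'
        rw [mul_div_assoc]
        exact mul_le_mul_of_nonneg_left (hborn N (by omega) hg t q Ωe' hlev') (by positivity)
      have hjmp := hJ' P c hP hc hc6 hcB μ hμ U hU hU9 hUB β hβmin hβc K hK L M hL3 hM3 (d * k) j hjk hjN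
        (klEffectiveAction L M β U μ K klE0 j - klTowerInput L M β U μ K d k) (partialIncr_momentumConserving β U μ K d k j) t (q + 1)
        (by omega) hp _ (by positivity) hbornW Ωe hlev
      refine hjmp.trans ?_
      have h27 : (27 : ℝ) ^ ((t : ℕ) + 1) ≤ (27 : ℝ) ^ 5 := pow_le_pow_right₀ (by norm_num) (by omega)
      have hsq : (C₂' ^ 2) ^ (q + 1) ≤ (max 1 (C₂' ^ 2)) ^ (q + 1) := pow_le_pow_left₀ (sq_nonneg _) (le_max_right _ _) _
      calc C₁' / C₂' * (C₂' ^ 2) ^ (q + 1) * ((27 : ℝ) ^ ((t : ℕ) + 1) *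
              (towerFO D σ μk (q + 1) + ∑ n' ∈ Icc 2 N, exp 1 * Φ ^ (n' - 1) * ψ ^ (q + 1) * towerS D τ μk n' (q + 1) +
                ψ ^ (q + 1) * exp 1 * towerV D τ μk * (Φ * towerV D τ μk) ^ N / (1 - Φ * towerV D τ μk)))
          ≤ C₁' / C₂' * (max 1 (C₂' ^ 2)) ^ (q + 1) * ((27 : ℝ) ^ 5 *
              (towerFO D σ μk (q + 1) + ∑ n' ∈ Icc 2 N, exp 1 * Φ ^ (n' - 1) * ψ ^ (q + 1) * towerS D τ μk n' (q + 1) +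
                ψ ^ (q + 1) * exp 1 * towerV D τ μk * (Φ * towerV D τ μk) ^ N / (1 - Φ * towerV D τ μk))) :=
            mul_le_mul (mul_le_mul_of_nonneg_left hsq (by positivity)) (mul_le_mul_of_nonneg_right h27 hk0) (by positivity) (by positivity)
        _ = _ := by ring
    · -- `j = dk`: the increment vanishes
      have h0 : klEffectiveAction L M β U μ K klE0 j - klTowerInput L M β U μ K d k = 0 := by
        rw [show j = d * k by omega]
        unfold klTowerInput
        exact sub_self _
      rw [h0, klLevNormOf_zero, zero_div]
      exact mul_nonneg (by positivity) hk0
  -- (4) E1 part 7 with the re-measured part under its own profile and the constant on the increment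
  have hfit := towerReadout_le_of_ro_mul (D := D) (μ := μk) hσ hΦ hψ hτ hlam hA'0 hQ'0 hCinc0 hDinc0 hμ0
    himp₁ himp₂ hprof3 hprof hx₁ hx₂ hx₃ hy hθ hp hpub hro hincj
  -- (5) the bracket under one law, and the levels right-hand side
  set Yl : ℝ := ι₁ * lam + ι₂ / (2 * Q') + ι₃ / (4 * Q' ^ 2) + A' * Q' / 4 with hYl
  have hYl0 : 0 ≤ Yl := by positivity
  have hTY : 0 ≤ τ * Yl := by positivity
  have hx10 : 0 ≤ 4 * σ * lam * Q' / (1 - 4 * σ * lam * Q') := div_nonneg (by positivity) (sub_nonneg.2 hx₁.le)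
  have hYy : 0 ≤ Φ * (τ * Yl) / (1 - Φ * (τ * Yl)) := div_nonneg (by positivity) (sub_nonneg.2 hy.le)
  have hbr := readoutBracket_le_law_mul_sharp hAro0 hQro0 hA'0 hQ'0 hψ hτ hx10 hTY hYy hCinc0.le hDinc1 (by omega : 1 ≤ p)
  have hfin : klLevNormOf L M β μ K j (2 * p) (klEffectiveAction L M β U μ K klE0 j) Ωe / klLevUnitF β M t p j ≤
      Atot * (B * epsCoupling P U j) ^ (p - 1) * Qtot ^ p := by
    refine hfit.trans ?_
    rw [hAtot, hQtot]
    calc lam ^ (p - 1) * (Aro * Qro ^ p + (27 : ℝ) ^ 5 * (C₁' / C₂') * (max 1 (C₂' ^ 2)) ^ p *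
            (A' * (4 * Q') ^ p * (4 * σ * lam * Q' / (1 - 4 * σ * lam * Q')) +
              exp 1 * ψ * (2 * τ * ψ * Q') ^ (p - 1) * (τ * Yl) * (Φ * (τ * Yl) / (1 - Φ * (τ * Yl)))))
        ≤ lam ^ (p - 1) * ((Aro + (27 : ℝ) ^ 5 * (C₁' / C₂') * (A' * (4 * σ * lam * Q' / (1 - 4 * σ * lam * Q')) +
              exp 1 * (τ * Yl) * (Φ * (τ * Yl) / (1 - Φ * (τ * Yl))) / (2 * τ * Q'))) *
            (max 1 (C₂' ^ 2) * max 1 (max Qro (max (4 * Q') (2 * τ * ψ * Q')))) ^ p) :=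
          mul_le_mul_of_nonneg_left hbr (by positivity)
      _ = (Aro + (27 : ℝ) ^ 5 * (C₁' / C₂') * (A' * (4 * σ * lam * Q' / (1 - 4 * σ * lam * Q')) +
              exp 1 * (τ * Yl) * (Φ * (τ * Yl) / (1 - Φ * (τ * Yl))) / (2 * τ * Q'))) *
            lam ^ (p - 1) * (max 1 (C₂' ^ 2) * max 1 (max Qro (max (4 * Q') (2 * τ * ψ * Q')))) ^ p := by ring
  have hAtot0 : 0 ≤ Atot := by rw [hAtot]; positivity
  have hQtot0 : 0 ≤ Qtot := by
    rw [hQtot]; exact mul_nonneg hDinc0.le (zero_le_one.trans (le_max_left _ _))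
  exact readoutLev_le_levelsRHS hβ hKl U hAtot0 hQtot0 hB hCE t (by omega) j hfin

end Summit.HubbardSuperconductivity.HubbardSuperconductivity.Theorems.EngineV8

end
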